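import Summits.QuantumFields.YangMills.Theorems.BalabanLadderUVSeamRecUnitDilation
import Summits.QuantumFields.YangMills.Theorems.LangevinControlUVOSLegsFromFemtoAndGapStubAssemblyUniformBoundMain
import Summits.QuantumFields.YangMills.Theorems.LangevinControlUVOSLegsFromFemtoAndGapStubAssemblyLowDegree
import Summits.QuantumFields.YangMills.Theorems.LangevinControlUVOSLegsFromFemtoAndGapStubAssemblyPlaneExpansion
import HarnessLib

/-!
# Crux `UVSeamRec` (stmt-QuantumFields-20043), stub `stub_floors`: unit transfer of the floors — I, preparations

Helper file (`--supports stmt-QuantumFields-20043`) of the lead prover of `stub_floors` (unit `ym-spine-20043-p1`);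
companion of `BalabanLadderUVSeamRecUnitDilation` (exact covariance under `u ↦ c · u`).

WHAT THE PINNED UNIT COSTS (the series `BalabanLadderUVSeamRecUnitTransfer*`).  The registered stub `stub_floors` of
crux `UVSeamRec` (stmt-QuantumFields-20043) asks for the non-triviality floors `LowerBounds SU(2) r uRec` at the
two-loop unit of record `uRec`.  Any engine (the NT line's femto package through the landed `stub_lower`, or Track A's
N32′) delivers floors at ITS OWN unit `a`, with COMPACTLY SUPPORTED bump witnesses (all `stub_lower` ever produces).
The series proves that such floors move to any unit `u` with `a β / u β → c₀ ∈ (0, ∞)` (asymptotic two-loop scaling of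
the engine's unit up to a constant) PROVIDED the density ceilings `MomentBounds G r u` (a fortiori the plane-resolved
`MomentBounds6 G r u` of the ceilings stub) hold at the target unit; mere two-sided comparability `c ≤ a/u ≤ C` does
not suffice by this argument (a floor for one witness does not control its dilates).

This file: a weighted-sum perturbation lemma; the geometry of compactly supported / positive-time / pairwise disjoint
bump witnesses (time floor, radius, separation, uniform modulus); lattice geometry at a smearing scale `s`; the collar
radius `R = ⌊ρ/u⌋` and the eventual scale bookkeeping along `u → 0⁺`, `a/u → 1`; the landed collar output
(`MomentBounds`, via `torusMoment_two/three` and `exists_valMinAbs_ge_of_norm_le` of the soft-assembly toolkit) in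
covariance / third-cumulant currency for bulk sites at sup distance `≥ 2R + 4`.
-/

set_option autoImplicit false

noncomputable section

open scoped SchwartzMap BigOperators
open MeasureTheory Filter Topology Metric
open Literature.MathematicalPhysics.QuantumFieldTheory Literature.MathematicalPhysics.QuantumLattice
open Literature.Probability.LatticeModels (box Site mem_box card_box)
open Summit.QuantumFields.YangMills.Cruxes.OSLegsFromFemtoAndGap.DlrCollarTransfer
open Summit.QuantumFields.YangMills.Theorems.OSLegsFromFemtoAndGap

namespace Summit.QuantumFields.YangMills.Cruxes.UVSeamRec.UnitTransfer

variable {G : Type} [Group G] [TopologicalSpace G] [IsTopologicalGroup G] [CompactSpace G]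
  [MeasurableSpace G] [BorelSpace G]

/-! ### A finite-sum perturbation lemma -/

/-- **Weighted-sum perturbation.** If every index at which one of the two weight families is non-zero lies in `T`,
carries a kernel value `|W| ≤ w` and a weight difference `≤ ω`, then the two weighted sums differ by at most
`#T · ω · w`. [folklore] -/
theorem abs_sum_mul_sub_sum_mul_le {α : Type*} (s T : Finset α) (φ ψ W : α → ℝ) {ω w : ℝ}
    (hω : 0 ≤ ω) (hw : 0 ≤ w)
    (h : ∀ p ∈ s, (φ p ≠ 0 ∨ ψ p ≠ 0) → p ∈ T ∧ |W p| ≤ w ∧ |φ p - ψ p| ≤ ω) :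
    |∑ p ∈ s, φ p * W p - ∑ p ∈ s, ψ p * W p| ≤ T.card * (ω * w) := by
  classical
  rw [← Finset.sum_sub_distrib]
  have hvan : ∀ p ∈ s, φ p * W p - ψ p * W p ≠ 0 → (φ p ≠ 0 ∨ ψ p ≠ 0) := by
    intro p _ hp
    by_contra hcon
    push Not at hcon
    exact hp (by rw [hcon.1, hcon.2]; ring)
  rw [← Finset.sum_filter_of_ne hvan]
  have hsub : s.filter (fun p => φ p ≠ 0 ∨ ψ p ≠ 0) ⊆ T := by
    intro p hp
    rw [Finset.mem_filter] at hp
    exact (h p hp.1 hp.2).1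
  calc |∑ p ∈ s.filter (fun p => φ p ≠ 0 ∨ ψ p ≠ 0), (φ p * W p - ψ p * W p)|
      ≤ ∑ p ∈ s.filter (fun p => φ p ≠ 0 ∨ ψ p ≠ 0), |φ p * W p - ψ p * W p| := Finset.abs_sum_le_sum_abs _ _
    _ ≤ ∑ p ∈ s.filter (fun p => φ p ≠ 0 ∨ ψ p ≠ 0), ω * w := by
        refine Finset.sum_le_sum fun p hp => ?_
        rw [Finset.mem_filter] at hp
        obtain ⟨-, hW, hd⟩ := h p hp.1 hp.2
        rw [← sub_mul, abs_mul]
        exact mul_le_mul hd hW (abs_nonneg _) hω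
    _ = (s.filter (fun p => φ p ≠ 0 ∨ ψ p ≠ 0)).card * (ω * w) := by rw [Finset.sum_const, nsmul_eq_mul]
    _ ≤ T.card * (ω * w) := by
        have := Finset.card_le_card hsub
        have hωw : 0 ≤ ω * w := mul_nonneg hω hw
        exact mul_le_mul_of_nonneg_right (by exact_mod_cast this) hωw

/-! ### Geometry of compactly supported test functions -/

/-- A compactly supported function with support in the open positive-time half-space is supported at times `≥ δ > 0`
and inside a ball of radius `M ≥ 1`. [folklore] -/
theorem exists_time_floor_and_radius {v : EuclideanSpace ℝ (Fin 4) → ℝ} (hK : HasCompactSupport v)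
    (hpos : tsupport v ⊆ {y : EuclideanSpace ℝ (Fin 4) | 0 < y 0}) :
    ∃ δ M : ℝ, 0 < δ ∧ 1 ≤ M ∧ ∀ z, v z ≠ 0 → δ ≤ z 0 ∧ ‖z‖ ≤ M := by
  obtain ⟨M₀, hM₀⟩ := hK.isCompact.isBounded.subset_closedBall (0 : EuclideanSpace ℝ (Fin 4))
  have hcont : Continuous fun y : EuclideanSpace ℝ (Fin 4) => y 0 := PiLp.continuous_apply 2 _ 0
  rcases (tsupport v).eq_empty_or_nonempty with hemp | hne
  · refine ⟨1, max M₀ 1, one_pos, le_max_right _ _, fun z hz => ?_⟩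
    have : z ∈ tsupport v := subset_tsupport v hz
    rw [hemp] at this
    exact absurd this (Set.notMem_empty z)
  · obtain ⟨z₀, hz₀, hmin⟩ := hK.isCompact.exists_isMinOn hne hcont.continuousOn
    refine ⟨z₀ 0, max M₀ 1, hpos hz₀, le_max_right _ _, fun z hz => ?_⟩
    have hzK : z ∈ tsupport v := subset_tsupport v hz
    refine ⟨hmin hzK, ?_⟩
    have := hM₀ hzK
    rw [mem_closedBall, dist_zero_right] at this
    exact this.trans (le_max_left _ _)

/-- Two compactly supported functions with disjoint supports are supported at mutual distance `≥ δ > 0`. [folklore] -/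
theorem exists_separation_of_disjoint {f g : EuclideanSpace ℝ (Fin 4) → ℝ} (hf : HasCompactSupport f)
    (h : Disjoint (tsupport f) (tsupport g)) :
    ∃ δ : ℝ, 0 < δ ∧ ∀ z z', f z ≠ 0 → g z' ≠ 0 → δ ≤ ‖z - z'‖ := by
  obtain ⟨δ, hδ, hdisj⟩ := h.exists_cthickenings hf.isCompact (isClosed_tsupport g)
  refine ⟨δ, hδ, fun z z' hz hz' => ?_⟩
  by_contra hlt
  push Not at hlt
  have hzK : z ∈ tsupport f := subset_tsupport f hz
  have hz'K : z' ∈ tsupport g := subset_tsupport g hz'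
  have h1 : z' ∈ cthickening δ (tsupport f) :=
    mem_cthickening_of_dist_le z' z δ (tsupport f) hzK (by rw [dist_eq_norm, norm_sub_rev]; exact hlt.le)
  have h2 : z' ∈ cthickening δ (tsupport g) := self_subset_cthickening _ hz'K
  exact Set.disjoint_left.1 hdisj h1 h2

/-- A compactly supported function is supported inside a ball of radius `M ≥ 1`. [folklore] -/
theorem exists_radius {f : EuclideanSpace ℝ (Fin 4) → ℝ} (hK : HasCompactSupport f) :
    ∃ M : ℝ, 1 ≤ M ∧ ∀ z, f z ≠ 0 → ‖z‖ ≤ M := by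
  obtain ⟨M₀, hM₀⟩ := hK.isCompact.isBounded.subset_closedBall (0 : EuclideanSpace ℝ (Fin 4))
  refine ⟨max M₀ 1, le_max_right _ _, fun z hz => ?_⟩
  have := hM₀ (subset_tsupport f hz)
  rw [mem_closedBall, dist_zero_right] at this
  exact this.trans (le_max_left _ _)

/-- Uniform continuity of a compactly supported Schwartz function, in `ε`–`δ` form. [folklore] -/
theorem exists_modulus (v : 𝓢(EuclideanSpace ℝ (Fin 4), ℝ)) (hK : HasCompactSupport (v : EuclideanSpace ℝ (Fin 4) → ℝ))
    {η : ℝ} (hη : 0 < η) :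
    ∃ θ₀ : ℝ, 0 < θ₀ ∧ ∀ z z' : EuclideanSpace ℝ (Fin 4), ‖z - z'‖ < θ₀ → |v z - v z'| < η := by
  have huc := hK.uniformContinuous_of_continuous v.continuous
  obtain ⟨θ₀, hθ₀, H⟩ := Metric.uniformContinuous_iff.1 huc η hη
  exact ⟨θ₀, hθ₀, fun z z' hzz' => by
    have := H (by rw [dist_eq_norm]; exact hzz')
    rwa [Real.dist_eq] at this⟩

/-! ### Lattice geometry at scale `s` -/

/-- The time coordinate of the smeared position of a site. [folklore] -/
theorem smul_siteToE_apply_zero (s : ℝ) (x : Site 4) : (s • siteToE x) 0 = s * (x 0 : ℝ) := by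
  simp [siteToE_apply]

/-- A site whose smeared position at scale `s > 0` lies in the ball of radius `M` has sup norm `≤ M / s`. [folklore] -/
theorem norm_le_div_of_smul_siteToE {s M : ℝ} (hs : 0 < s) (x : Site 4) (h : ‖s • siteToE x‖ ≤ M) :
    ‖x‖ ≤ M / s := by
  rw [le_div_iff₀ hs, mul_comm]
  exact (mul_norm_le_norm_smul_siteToE hs.le x).trans h

/-- A site of sup norm `≤ N` (`N : ℕ`) lies in `box 4 N`. [folklore] -/
theorem mem_box_of_norm_le {N : ℕ} (x : Site 4) (h : ‖x‖ ≤ (N : ℝ)) : x ∈ box 4 N := by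
  rw [mem_box]
  intro i
  have hi : ‖x i‖ ≤ ‖x‖ := norm_le_pi_norm x i
  rw [Int.norm_eq_abs] at hi
  have h' : |((x i : ℤ) : ℝ)| ≤ (N : ℝ) := hi.trans h
  have h'' : |x i| ≤ (N : ℤ) := by exact_mod_cast h'
  constructor <;> linarith [abs_le.1 h'']

/-- Time separation at scale `s`: if `s · x₀ ≤ −δ` and `δ ≤ s · y₀` then `‖x − y‖ ≥ 2δ/s`. [folklore] -/
theorem norm_sub_ge_of_time_sep {s δ : ℝ} (hs : 0 < s) (x y : Site 4) (hx : s * (x 0 : ℝ) ≤ -δ)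
    (hy : δ ≤ s * (y 0 : ℝ)) : 2 * δ / s ≤ ‖x - y‖ := by
  have h1 : ‖(x - y) 0‖ ≤ ‖x - y‖ := norm_le_pi_norm (x - y) 0
  rw [Int.norm_eq_abs] at h1
  have h2 : 2 * δ / s ≤ |(((x - y) 0 : ℤ) : ℝ)| := by
    rw [div_le_iff₀ hs]
    have : (((x - y) 0 : ℤ) : ℝ) = (x 0 : ℝ) - (y 0 : ℝ) := by push_cast [Pi.sub_apply]; ring
    rw [this, abs_sub_comm]
    calc 2 * δ ≤ s * (y 0 : ℝ) - s * (x 0 : ℝ) := by linarith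
      _ = (↑(y 0) - ↑(x 0)) * s := by ring
      _ ≤ |(y 0 : ℝ) - (x 0 : ℝ)| * s := mul_le_mul_of_nonneg_right (le_abs_self _) hs.le
  exact h2.trans h1

/-- Spatial separation at scale `s`: physical separation `≥ δ` forces lattice sup-separation `≥ δ/(2s)`. [folklore] -/
theorem norm_sub_ge_of_sep {s δ : ℝ} (hs : 0 < s) (x y : Site 4) (h : δ ≤ ‖s • siteToE x - s • siteToE y‖) :
    δ / (2 * s) ≤ ‖x - y‖ := by
  rw [div_le_iff₀ (by positivity)]
  calc δ ≤ ‖s • siteToE x - s • siteToE y‖ := h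
    _ ≤ 2 * s * ‖x - y‖ := norm_smul_siteToE_sub_le hs.le x y
    _ = ‖x - y‖ * (2 * s) := by ring

/-! ### The collar radius and the eventual scale bookkeeping -/

/-- The collar radius `R = ⌊ρ/u⌋` for `0 < u ≤ ρ/2`: `1 ≤ R`, `R u ≤ ρ`, `ρ/(2u) ≤ R`. [folklore] -/
theorem collar_radius {ρ u : ℝ} (hρ : 0 < ρ) (hu : 0 < u) (huρ : u ≤ ρ / 2) :
    1 ≤ ⌊ρ / u⌋₊ ∧ (⌊ρ / u⌋₊ : ℝ) * u ≤ ρ ∧ ρ / (2 * u) ≤ (⌊ρ / u⌋₊ : ℝ) := by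
  have hρu : 2 ≤ ρ / u := by rw [le_div_iff₀ hu]; linarith
  have h0 : 0 ≤ ρ / u := by positivity
  refine ⟨?_, ?_, ?_⟩
  · exact Nat.le_floor (by exact_mod_cast (by linarith : (1 : ℝ) ≤ ρ / u))
  · calc (⌊ρ / u⌋₊ : ℝ) * u ≤ ρ / u * u := mul_le_mul_of_nonneg_right (Nat.floor_le h0) hu.le
      _ = ρ := div_mul_cancel₀ ρ hu.ne'
  · have hlt := Nat.lt_floor_add_one (ρ / u)
    have : ρ / (2 * u) = ρ / u / 2 := by rw [div_div, mul_comm]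
    rw [this]
    linarith

/-- **Eventual scale bookkeeping.**  Along `β → ∞`, with `u → 0⁺` and `a/u → 1`: beyond some `β₀` all thresholds hold —
`β ≥ β₄, β₅`, `u/2 ≤ a ≤ 2u`, `u ≤ 1`, `2M|1 − a/u| < θ₀`, `u ≤ δ/8`, `u ≤ ρ/2`. [folklore] -/
theorem eventually_scales {a u : ℝ → ℝ} (hu : ∀ β, 0 < u β) (hu0 : Tendsto u atTop (𝓝 0))
    (hau : Tendsto (fun β => a β / u β) atTop (𝓝 1)) (β₄ β₅ : ℝ) {M θ₀ δ ρ : ℝ} (hM : 1 ≤ M) (hθ₀ : 0 < θ₀)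
    (hδ : 0 < δ) (hρ : 0 < ρ) :
    ∃ β₀ : ℝ, ∀ β, β₀ ≤ β → β₄ ≤ β ∧ β₅ ≤ β ∧ u β / 2 ≤ a β ∧ a β ≤ 2 * u β ∧ u β ≤ 1 ∧
      2 * M * |1 - a β / u β| < θ₀ ∧ u β ≤ δ / 8 ∧ u β ≤ ρ / 2 := by
  have hM0 : 0 < M := by linarith
  have e1 : ∀ᶠ β in atTop, β₄ ≤ β := eventually_ge_atTop β₄
  have e2 : ∀ᶠ β in atTop, β₅ ≤ β := eventually_ge_atTop β₅
  have e3 : ∀ᶠ β in atTop, a β / u β ∈ Set.Ioo (1 / 2 : ℝ) 2 :=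
    hau.eventually (Ioo_mem_nhds (by norm_num) (by norm_num))
  have e4 : ∀ᶠ β in atTop, a β / u β ∈ ball (1 : ℝ) (θ₀ / (2 * M)) :=
    hau.eventually (ball_mem_nhds _ (by positivity))
  have e5 : ∀ᶠ β in atTop, u β < min 1 (min (δ / 8) (ρ / 2)) :=
    hu0.eventually (gt_mem_nhds (by positivity))
  obtain ⟨β₀, hβ₀⟩ := Filter.eventually_atTop.1 (((e1.and e2).and (e3.and e4)).and e5)
  refine ⟨β₀, fun β hβ => ?_⟩
  obtain ⟨⟨⟨h1, h2⟩, ⟨h3, h4⟩⟩, h5⟩ := hβ₀ β hβ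
  have huβ := hu β
  rw [Set.mem_Ioo] at h3
  rw [mem_ball, Real.dist_eq] at h4
  have hlo : u β / 2 ≤ a β := by
    have := h3.1; rw [lt_div_iff₀ huβ] at this; linarith
  have hhi : a β ≤ 2 * u β := by
    have := h3.2; rw [div_lt_iff₀ huβ] at this; linarith
  have hmin1 : u β ≤ 1 := (h5.le.trans (min_le_left _ _))
  have hmin2 : u β ≤ δ / 8 := h5.le.trans ((min_le_right _ _).trans (min_le_left _ _))
  have hmin3 : u β ≤ ρ / 2 := h5.le.trans ((min_le_right _ _).trans (min_le_right _ _))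
  refine ⟨h1, h2, hlo, hhi, hmin1, ?_, hmin2, hmin3⟩
  rw [abs_sub_comm] at h4
  calc 2 * M * |1 - a β / u β| < 2 * M * (θ₀ / (2 * M)) := mul_lt_mul_of_pos_left h4 (by positivity)
    _ = θ₀ := by field_simp

/-! ### The collar output at two and three points, in covariance / cumulant currency -/

/-- **Two-point collar bound**: under the unpacked `MomentBounds` estimate at `(β, L, R)`, two bulk sites
(`2‖x‖, 2‖y‖ ≤ L`) at sup distance `≥ 2R + 4` have `|Cov(A_x, A_y)| ≤ (C/R⁴)²`. [folklore] -/
theorem abs_cov_le (r : LatticeRep G) {C : ℝ} {β : ℝ} {L R : ℕ}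
    (H : ∀ (n : ℕ) (x : Fin n → Site 4),
      (∀ i j : Fin n, i ≠ j → ∃ k : Fin 4,
        (2 * (R : ℤ) + 4) ≤ |((((x i k - x j k : ℤ) : ZMod (2 * L + 1))).valMinAbs : ℤ)|) →
      |torusMoment r.ρ β L r.curvature.F (wilsonTorusMean r.ρ β L r.curvature.F) x| ≤ (C / (R : ℝ) ^ 4) ^ n)
    (x y : Site 4) (hx : 2 * ‖x‖ ≤ (L : ℝ)) (hy : 2 * ‖y‖ ≤ (L : ℝ)) (hfar : (2 * (R : ℝ) + 4) ≤ ‖x - y‖) :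
    |torusE G r β L (fun U => dens G r x U * dens G r y U) - torusE G r β L (dens G r x) * torusE G r β L (dens G r y)|
      ≤ (C / (R : ℝ) ^ 4) ^ 2 := by
  have h2 := torusMoment_two (G := G) r β L ![x, y]
  simp only [Matrix.cons_val_zero, Matrix.cons_val_one] at h2
  rw [← h2]
  refine H 2 ![x, y] fun i j hij => ?_
  have hwrap : ∀ i : Fin 2, 2 * ‖(![x, y] : Fin 2 → Site 4) i‖ ≤ (L : ℝ) := by
    intro i; fin_cases i <;> simpa using by assumption
  have hdist : (2 * (R : ℝ) + 4) ≤ ‖(![x, y] : Fin 2 → Site 4) i - (![x, y] : Fin 2 → Site 4) j‖ := by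
    fin_cases i <;> fin_cases j
    · exact absurd rfl hij
    · simpa using hfar
    · simpa [norm_sub_rev] using hfar
    · exact absurd rfl hij
  obtain ⟨k, hk⟩ := exists_valMinAbs_ge_of_norm_le (L := L) ![x, y] hwrap i j hdist
  exact ⟨k, by exact_mod_cast hk⟩

/-- **Three-point collar bound**: three bulk sites at pairwise sup distance `≥ 2R + 4` have
`|κ₃(A_x, A_y, A_z)| ≤ (C/R⁴)³`. [folklore] -/
theorem abs_torusK3_le (r : LatticeRep G) {C : ℝ} {β : ℝ} {L R : ℕ}
    (H : ∀ (n : ℕ) (x : Fin n → Site 4),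
      (∀ i j : Fin n, i ≠ j → ∃ k : Fin 4,
        (2 * (R : ℤ) + 4) ≤ |((((x i k - x j k : ℤ) : ZMod (2 * L + 1))).valMinAbs : ℤ)|) →
      |torusMoment r.ρ β L r.curvature.F (wilsonTorusMean r.ρ β L r.curvature.F) x| ≤ (C / (R : ℝ) ^ 4) ^ n)
    (x y z : Site 4) (hx : 2 * ‖x‖ ≤ (L : ℝ)) (hy : 2 * ‖y‖ ≤ (L : ℝ)) (hz : 2 * ‖z‖ ≤ (L : ℝ))
    (hxy : (2 * (R : ℝ) + 4) ≤ ‖x - y‖) (hxz : (2 * (R : ℝ) + 4) ≤ ‖x - z‖) (hyz : (2 * (R : ℝ) + 4) ≤ ‖y - z‖) :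
    |torusK3 G r β L x y z| ≤ (C / (R : ℝ) ^ 4) ^ 3 := by
  have h3 := torusMoment_three (G := G) r β L ![x, y, z]
  simp only [Matrix.cons_val_zero, Matrix.cons_val_one, Matrix.head_cons, Matrix.cons_val_two, Matrix.tail_cons] at h3
  rw [← h3]
  refine H 3 ![x, y, z] fun i j hij => ?_
  have hwrap : ∀ i : Fin 3, 2 * ‖(![x, y, z] : Fin 3 → Site 4) i‖ ≤ (L : ℝ) := by
    intro i; fin_cases i <;> simpa using by assumption
  have hdist : (2 * (R : ℝ) + 4) ≤ ‖(![x, y, z] : Fin 3 → Site 4) i - (![x, y, z] : Fin 3 → Site 4) j‖ := by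
    fin_cases i <;> fin_cases j
    · exact absurd rfl hij
    · simpa using hxy
    · simpa using hxz
    · simpa [norm_sub_rev] using hxy
    · exact absurd rfl hij
    · simpa using hyz
    · simpa [norm_sub_rev] using hxz
    · simpa [norm_sub_rev] using hyz
    · exact absurd rfl hij
  obtain ⟨k, hk⟩ := exists_valMinAbs_ge_of_norm_le (L := L) ![x, y, z] hwrap i j hdist
  exact ⟨k, by exact_mod_cast hk⟩

end Summit.QuantumFields.YangMills.Cruxes.UVSeamRec.UnitTransfer

end
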